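import Summits.Parity.GeneralizedHardyLittlewood.Theorems.PrimeLevelFamEdgeMomentsBeyondDiagonalDiagDecorShiftedBlockDecorTwoSel
import Summits.Parity.GeneralizedHardyLittlewood.Theorems.PrimeLevelFamEdgeMomentsBeyondDiagonalDiagDecorShiftedP2Lpow
import HarnessLib

/-!
# Route `PrimeLevelFamEdge`, crux K_A `MomentsBeyondDiagonal` (stmt-Parity-20007), line «petersson_layers» v4, stub `stub_diag`:
# **the TWO-SIDED `P₂⊗P₂`-decorated `L`-power weights: for every `m`,
# `Sel(τP₂(k₁)·τP₂(k₂)·L^m) = (π²/6)²·Ξ_m(λ,P)·log^{m+1}M + O(log^mM)`,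
# `Ξ_m = Σ_{j≤m}Σ_{i≤j} C(m,j)C(j,i)2^{m−j}∫₀¹(λ−u)^{m−j}(−2u^iP(u))(−2u^{j−i}P(u))du`**, `L = 2λlog M − 2log g − log k₁ − log k₂`

Census R3(ii), ANALYTIC HALF — the genuinely two-sided monomial family of order `(2,2)`
(`…DiagDecorOrderRungTwoHecke.heckeSum_orderTwoTwo_eq`: the `6P₂(k₁)P₂(k₂)` part of `3S₂² − 2S₄` in `W₂₂`, times the polynomial
parts `Π_ab(L)`), for every `m`, from the two-sided block `…DiagDecorShiftedBlockDecorTwoSel.abs_selbergBlockPrimeSqTwo_sub_le`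
exactly as `…DiagDecorShiftedP2Lpow` (p825511) got the one-sided family from `abs_selbergBlockPrimeSq_sub_le`:

* `tauP2TauP2_Lpow_eq_sum_blocks` — pointwise `L^m = Σ C(m,j)C(j,i)2^{m−j}ℓ⁺(k₁)^iℓ⁺(k₂)^{j−i}B^{m−j}` with both decorations;
* `abs_selbergP2P2Lpow_sub_le` — **the displayed asymptotic** (normalisation `log^mM·log M/log⁰M`).

With `…DiagDecorShiftedLpow` (`ττL^m`), `…DiagDecorShiftedP2Lpow` (`τP₂τL^m`, both sides) and this file, every monomial family
carrying a TOP-ORDER main term at order `(2,2)` is evaluated; the `M_4 = τ(3P₂²−2P₄)`-decorated families need only crude bounds.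
Def-free; theorems only. Helper `--supports stmt-Parity-20007`; closes nothing; K_A, K_B and the Parity summit are NOT proved;
nothing about Landau–Siegel zeros.

## References
* E. Kowalski, P. Michel, J. VanderKam, J. reine angew. Math. 526 (2000), (23)–(28) pp. 13–15 and Prop. 5.1 p. 18.
  [cite: KowalskiMichelVanderKam2000, (23)–(28) — derivation (order-(2,2) monomials of the diagonal main term)]
-/

noncomputable section

open scoped Real ArithmeticFunction.Moebius
open Finset ArithmeticFunction Polynomial MeasureTheory intervalIntegral

namespace Summit.Parity.GeneralizedHardyLittlewood.Theorems.MomentsBeyondDiagonal.DiagKernel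

open Literature.NumberTheory.LFunctions Literature.NumberTheory.LFunctions.KMV2000
open MollifierMainTerm (W)
open Literature.NumberTheory.Sieve (one_le_log_of_three_le)


/-! ### `L = 2B + ℓ⁺(k₁) + ℓ⁺(k₂)` -/

/-- **Pointwise block expansion**: for `M > 0` and `c, g, k₁, k₂ ≥ 1`, with `ℓ⁺(k) = log((M/(cg))/k)`,
`B = λlog M − log g − log(M/(cg))`:
`τP₂(k₁)·τP₂(k₂)·(2λlog M − 2log g − log k₁ − log k₂)^m = Σ_{j≤m}Σ_{i≤j} C(m,j)C(j,i)2^{m−j}·(τP₂(k₁)ℓ⁺(k₁)^i)(τP₂(k₂)ℓ⁺(k₂)^{j−i})B^{m−j}`.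
[cite: KowalskiMichelVanderKam2000, (23) — derivation] -/
theorem tauP2TauP2_Lpow_eq_sum_blocks {M : ℝ} (hM : 0 < M) (lam : ℝ) (m : ℕ) {c g k₁ k₂ : ℕ} (hc : c ≠ 0)
    (hg : g ≠ 0) (hk₁ : k₁ ≠ 0) (hk₂ : k₂ ≠ 0) :
    (k₁.divisors.card : ℝ) * (∑ p ∈ k₁.primeFactors, Real.log p ^ 2) *
          ((k₂.divisors.card : ℝ) * (∑ p ∈ k₂.primeFactors, Real.log p ^ 2)) *
        (2 * (lam * Real.log M) - 2 * Real.log g - Real.log k₁ - Real.log k₂) ^ m =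
      ∑ j ∈ Finset.range (m + 1), ∑ i ∈ Finset.range (j + 1),
        (m.choose j : ℝ) * (j.choose i : ℝ) * 2 ^ (m - j) *
          (((k₁.divisors.card : ℝ) * (∑ p ∈ k₁.primeFactors, Real.log p ^ 2) *
              Real.log (M / ((c * g : ℕ) : ℝ) / k₁) ^ i) *
            ((k₂.divisors.card : ℝ) * (∑ p ∈ k₂.primeFactors, Real.log p ^ 2) *
              Real.log (M / ((c * g : ℕ) : ℝ) / k₂) ^ (j - i)) *
            (lam * Real.log M - Real.log g - Real.log (M / ((c * g : ℕ) : ℝ))) ^ (m - j)) := by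
  have hcg : (0 : ℝ) < ((c * g : ℕ) : ℝ) := by exact_mod_cast Nat.pos_of_ne_zero (mul_ne_zero hc hg)
  have hY : M / ((c * g : ℕ) : ℝ) ≠ 0 := (div_pos hM hcg).ne'
  have h1 : Real.log (M / ((c * g : ℕ) : ℝ) / k₁) = Real.log (M / ((c * g : ℕ) : ℝ)) - Real.log k₁ :=
    Real.log_div hY (by exact_mod_cast hk₁)
  have h2 : Real.log (M / ((c * g : ℕ) : ℝ) / k₂) = Real.log (M / ((c * g : ℕ) : ℝ)) - Real.log k₂ :=
    Real.log_div hY (by exact_mod_cast hk₂)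
  have hL : 2 * (lam * Real.log M) - 2 * Real.log g - Real.log k₁ - Real.log k₂ =
      (Real.log (M / ((c * g : ℕ) : ℝ) / k₁) + Real.log (M / ((c * g : ℕ) : ℝ) / k₂)) +
        2 * (lam * Real.log M - Real.log g - Real.log (M / ((c * g : ℕ) : ℝ))) := by
    rw [h1, h2]; ring
  rw [hL, add_pow, Finset.mul_sum]
  refine Finset.sum_congr rfl fun j _ ↦ ?_
  rw [add_pow, mul_pow, Finset.sum_mul, Finset.sum_mul, Finset.mul_sum]
  refine Finset.sum_congr rfl fun i _ ↦ ?_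
  ring

/-! ### The `L`-power asymptotic -/

/-- **`Sel(τP₂(k₁)·τP₂(k₂)·L^m) = (π²/6)²Ξ_m·log^{m+1}M + O(log^mM)`** for every `m`, `0 ≤ λ ≤ 1`, `P₀ = P₁ = 0`
(see the module docstring; written with the trivial normalisation `/log⁰M` to keep the block format). [cite: KowalskiMichelVanderKam2000, (23)–(28) and Prop. 5.1 — derivation] -/
theorem abs_selbergP2P2Lpow_sub_le (P : ℝ[X]) (hP0 : P.coeff 0 = 0) (hP1 : P.coeff 1 = 0) (m : ℕ)
    {lam : ℝ} (hlam0 : 0 ≤ lam) (hlam1 : lam ≤ 1) :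
    ∃ C : ℝ, 0 < C ∧ ∀ M : ℝ, 3 ≤ M →
      |∑ c ∈ Icc 1 ⌊M⌋₊, ∑ g ∈ Icc 1 (⌊M⌋₊ / c), (μ g : ℝ) * c *
          ∑ k₁ ∈ Icc 1 (⌊M⌋₊ / (c * g)), ∑ k₂ ∈ Icc 1 (⌊M⌋₊ / (c * g)),
            ((μ (c * g * k₁) : ℝ) * ((psi (c * g * k₁))⁻¹ *
                P.eval (Real.log (M / ((c * g * k₁ : ℕ) : ℝ)) / Real.log M))) / ((c * g * k₁ : ℕ) : ℝ) *
              (((μ (c * g * k₂) : ℝ) * ((psi (c * g * k₂))⁻¹ *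
                P.eval (Real.log (M / ((c * g * k₂ : ℕ) : ℝ)) / Real.log M))) / ((c * g * k₂ : ℕ) : ℝ)) *
              ((k₁.divisors.card : ℝ) * (∑ p ∈ k₁.primeFactors, Real.log p ^ 2) *
          ((k₂.divisors.card : ℝ) * (∑ p ∈ k₂.primeFactors, Real.log p ^ 2)) *
                (2 * (lam * Real.log M) - 2 * Real.log g - Real.log k₁ - Real.log k₂) ^ m) -
        (π ^ 2 / 6) ^ 2 * (∑ j ∈ Finset.range (m + 1), ∑ i ∈ Finset.range (j + 1),
            (m.choose j : ℝ) * (j.choose i : ℝ) * 2 ^ (m - j) *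
              ∫ u in (0 : ℝ)..1, (((Polynomial.C lam - X) ^ (m - j) * (-(2 : ℝ) • (X ^ i * P))) *
                (-(2 : ℝ) • (X ^ (j - i) * P))).eval u) *
          Real.log M ^ m * Real.log M / Real.log M ^ 0| ≤
        C * Real.log M ^ m / Real.log M ^ 0 := by
  -- one constant per block `(j, i)`
  have hex : ∀ j i : ℕ, ∃ C : ℝ, 0 < C ∧ ∀ M : ℝ, 3 ≤ M →
      |∑ c ∈ Icc 1 ⌊M⌋₊, ∑ g ∈ Icc 1 (⌊M⌋₊ / c), (μ g : ℝ) * c *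
          ∑ k₁ ∈ Icc 1 (⌊M⌋₊ / (c * g)), ∑ k₂ ∈ Icc 1 (⌊M⌋₊ / (c * g)),
            ((μ (c * g * k₁) : ℝ) * ((psi (c * g * k₁))⁻¹ *
                P.eval (Real.log (M / ((c * g * k₁ : ℕ) : ℝ)) / Real.log M))) / ((c * g * k₁ : ℕ) : ℝ) *
              (((μ (c * g * k₂) : ℝ) * ((psi (c * g * k₂))⁻¹ *
                P.eval (Real.log (M / ((c * g * k₂ : ℕ) : ℝ)) / Real.log M))) / ((c * g * k₂ : ℕ) : ℝ)) *
              (((k₁.divisors.card : ℝ) * (∑ p ∈ k₁.primeFactors, Real.log p ^ 2) *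
                  Real.log (M / ((c * g : ℕ) : ℝ) / k₁) ^ i) *
                ((k₂.divisors.card : ℝ) * (∑ p ∈ k₂.primeFactors, Real.log p ^ 2) *
              Real.log (M / ((c * g : ℕ) : ℝ) / k₂) ^ (j - i)) *
                (lam * Real.log M - Real.log g - Real.log (M / ((c * g : ℕ) : ℝ))) ^ (m - j)) -
        (π ^ 2 / 6) ^ 2 * (∫ u in (0 : ℝ)..1,
            (((Polynomial.C lam - X) ^ (m - j) * ((fun r' : ℕ ↦ -(2 : ℝ) • (X ^ r' * P)) i)) *
              ((fun r' : ℕ ↦ -(2 : ℝ) • (X ^ r' * P)) (j - i))).eval u) *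
          Real.log M ^ ((m - j) + i + (j - i)) * Real.log M / Real.log M ^ (0 + 0)| ≤
        C * Real.log M ^ ((m - j) + i + (j - i)) / Real.log M ^ (0 + 0) := by
    intro j i
    exact abs_selbergBlockPrimeSqTwo_sub_le P hP0 hP1 (m - j) i (j - i) hlam0 hlam1
  choose Cb hCb0 hCb using hex
  set K : ℝ := ∑ j ∈ Finset.range (m + 1), ∑ i ∈ Finset.range (j + 1),
    (m.choose j : ℝ) * (j.choose i : ℝ) * 2 ^ (m - j) * Cb j i with hK
  have hK0 : 0 ≤ K := Finset.sum_nonneg fun j _ ↦ Finset.sum_nonneg fun i _ ↦ by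
    have := hCb0 j i; positivity
  refine ⟨K + 1, by positivity, fun M hM ↦ ?_⟩
  have hℓ1 : 1 ≤ Real.log M := one_le_log_of_three_le hM
  have hℓpos : 0 < Real.log M := by linarith
  have hM0 : 0 < M := by linarith
  set Xe : ℝ := Real.log M ^ m / Real.log M ^ 0 with hXe
  have hXe0 : 0 ≤ Xe := by positivity
  -- Step 1: expand the weight pointwise and use linearity
  have hpt : ∀ c ∈ Icc 1 ⌊M⌋₊, ∀ g ∈ Icc 1 (⌊M⌋₊ / c), ∀ k₁ ∈ Icc 1 (⌊M⌋₊ / (c * g)), ∀ k₂ ∈ Icc 1 (⌊M⌋₊ / (c * g)),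
      ((μ (c * g * k₁) : ℝ) * ((psi (c * g * k₁))⁻¹ *
          P.eval (Real.log (M / ((c * g * k₁ : ℕ) : ℝ)) / Real.log M))) / ((c * g * k₁ : ℕ) : ℝ) *
        (((μ (c * g * k₂) : ℝ) * ((psi (c * g * k₂))⁻¹ *
          P.eval (Real.log (M / ((c * g * k₂ : ℕ) : ℝ)) / Real.log M))) / ((c * g * k₂ : ℕ) : ℝ)) *
        ((k₁.divisors.card : ℝ) * (∑ p ∈ k₁.primeFactors, Real.log p ^ 2) *
          ((k₂.divisors.card : ℝ) * (∑ p ∈ k₂.primeFactors, Real.log p ^ 2)) *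
          (2 * (lam * Real.log M) - 2 * Real.log g - Real.log k₁ - Real.log k₂) ^ m) =
      ((μ (c * g * k₁) : ℝ) * ((psi (c * g * k₁))⁻¹ *
          P.eval (Real.log (M / ((c * g * k₁ : ℕ) : ℝ)) / Real.log M))) / ((c * g * k₁ : ℕ) : ℝ) *
        (((μ (c * g * k₂) : ℝ) * ((psi (c * g * k₂))⁻¹ *
          P.eval (Real.log (M / ((c * g * k₂ : ℕ) : ℝ)) / Real.log M))) / ((c * g * k₂ : ℕ) : ℝ)) *
        ∑ j ∈ Finset.range (m + 1), (fun (j c g k₁ k₂ : ℕ) ↦ ∑ i ∈ Finset.range (j + 1),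
          (m.choose j : ℝ) * (j.choose i : ℝ) * 2 ^ (m - j) *
          (((k₁.divisors.card : ℝ) * (∑ p ∈ k₁.primeFactors, Real.log p ^ 2) *
              Real.log (M / ((c * g : ℕ) : ℝ) / k₁) ^ i) *
            ((k₂.divisors.card : ℝ) * (∑ p ∈ k₂.primeFactors, Real.log p ^ 2) *
              Real.log (M / ((c * g : ℕ) : ℝ) / k₂) ^ (j - i)) *
            (lam * Real.log M - Real.log g - Real.log (M / ((c * g : ℕ) : ℝ))) ^ (m - j))) j c g k₁ k₂ := by
    intro c hc g hg k₁ hk₁ k₂ hk₂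
    have hc0 : c ≠ 0 := by have := (Finset.mem_Icc.1 hc).1; omega
    have hg0 : g ≠ 0 := by have := (Finset.mem_Icc.1 hg).1; omega
    have hk₁0 : k₁ ≠ 0 := by have := (Finset.mem_Icc.1 hk₁).1; omega
    have hk₂0 : k₂ ≠ 0 := by have := (Finset.mem_Icc.1 hk₂).1; omega
    rw [tauP2TauP2_Lpow_eq_sum_blocks hM0 lam m hc0 hg0 hk₁0 hk₂0]
  rw [Finset.sum_congr rfl fun c hc ↦ Finset.sum_congr rfl fun g hg ↦ congrArg _
    (Finset.sum_congr rfl fun k₁ hk₁ ↦ Finset.sum_congr rfl fun k₂ hk₂ ↦ hpt c hc g hg k₁ hk₁ k₂ hk₂),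
    selbergProd_finset_sum P M (Finset.range (m + 1))]
  rw [Finset.sum_congr rfl fun j _ ↦ selbergProd_finset_sum P M (Finset.range (j + 1))
    (fun (i c g k₁ k₂ : ℕ) ↦ (m.choose j : ℝ) * (j.choose i : ℝ) * 2 ^ (m - j) *
      (((k₁.divisors.card : ℝ) * (∑ p ∈ k₁.primeFactors, Real.log p ^ 2) *
          Real.log (M / ((c * g : ℕ) : ℝ) / k₁) ^ i) *
        ((k₂.divisors.card : ℝ) * (∑ p ∈ k₂.primeFactors, Real.log p ^ 2) *
              Real.log (M / ((c * g : ℕ) : ℝ) / k₂) ^ (j - i)) *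
        (lam * Real.log M - Real.log g - Real.log (M / ((c * g : ℕ) : ℝ))) ^ (m - j)))]
  simp only [selbergProd_const_mul]
  -- Step 2: the main term as the same double sum, and the termwise block asymptotics
  rw [Finset.mul_sum, Finset.sum_mul, Finset.sum_mul, Finset.sum_div, ← Finset.sum_sub_distrib]
  have hterm : ∀ j ∈ Finset.range (m + 1),
      |∑ i ∈ Finset.range (j + 1), (m.choose j : ℝ) * (j.choose i : ℝ) * 2 ^ (m - j) *
          ∑ c ∈ Icc 1 ⌊M⌋₊, ∑ g ∈ Icc 1 (⌊M⌋₊ / c), (μ g : ℝ) * c *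
            ∑ k₁ ∈ Icc 1 (⌊M⌋₊ / (c * g)), ∑ k₂ ∈ Icc 1 (⌊M⌋₊ / (c * g)),
              ((μ (c * g * k₁) : ℝ) * ((psi (c * g * k₁))⁻¹ *
                  P.eval (Real.log (M / ((c * g * k₁ : ℕ) : ℝ)) / Real.log M))) / ((c * g * k₁ : ℕ) : ℝ) *
                (((μ (c * g * k₂) : ℝ) * ((psi (c * g * k₂))⁻¹ *
                  P.eval (Real.log (M / ((c * g * k₂ : ℕ) : ℝ)) / Real.log M))) / ((c * g * k₂ : ℕ) : ℝ)) *
                (((k₁.divisors.card : ℝ) * (∑ p ∈ k₁.primeFactors, Real.log p ^ 2) *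
                    Real.log (M / ((c * g : ℕ) : ℝ) / k₁) ^ i) *
                  ((k₂.divisors.card : ℝ) * (∑ p ∈ k₂.primeFactors, Real.log p ^ 2) *
              Real.log (M / ((c * g : ℕ) : ℝ) / k₂) ^ (j - i)) *
                  (lam * Real.log M - Real.log g - Real.log (M / ((c * g : ℕ) : ℝ))) ^ (m - j)) -
        (π ^ 2 / 6) ^ 2 * (∑ i ∈ Finset.range (j + 1),
            (m.choose j : ℝ) * (j.choose i : ℝ) * 2 ^ (m - j) *
              ∫ u in (0 : ℝ)..1, (((Polynomial.C lam - X) ^ (m - j) * (-(2 : ℝ) • (X ^ i * P))) *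
                (-(2 : ℝ) • (X ^ (j - i) * P))).eval u) *
          Real.log M ^ m * Real.log M / Real.log M ^ 0| ≤
        (∑ i ∈ Finset.range (j + 1), (m.choose j : ℝ) * (j.choose i : ℝ) * 2 ^ (m - j) * Cb j i) * Xe := by
    intro j hj
    have hjm : j ≤ m := Nat.lt_succ_iff.1 (Finset.mem_range.1 hj)
    rw [Finset.mul_sum, Finset.sum_mul, Finset.sum_mul, Finset.sum_div, ← Finset.sum_sub_distrib, Finset.sum_mul]
    refine (Finset.abs_sum_le_sum_abs _ _).trans (Finset.sum_le_sum fun i hi ↦ ?_)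
    have hij : i ≤ j := Nat.lt_succ_iff.1 (Finset.mem_range.1 hi)
    have e : (m - j) + i + (j - i) = m := by omega
    have h := hCb j i M hM
    rw [e, Nat.zero_add] at h
    rw [show ∀ (a S I : ℝ), a * S - (π ^ 2 / 6) ^ 2 * (a * I) * Real.log M ^ m * Real.log M / Real.log M ^ 0 =
        a * (S - (π ^ 2 / 6) ^ 2 * I * Real.log M ^ m * Real.log M / Real.log M ^ 0) from fun a S I ↦ by ring,
      abs_mul, abs_of_nonneg (by positivity : (0 : ℝ) ≤ (m.choose j : ℝ) * (j.choose i : ℝ) * 2 ^ (m - j)),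
      mul_assoc ((m.choose j : ℝ) * (j.choose i : ℝ) * 2 ^ (m - j)) (Cb j i) Xe]
    refine mul_le_mul_of_nonneg_left ?_ (by positivity)
    rw [hXe, ← mul_div_assoc]
    exact h
  refine (Finset.abs_sum_le_sum_abs _ _).trans ((Finset.sum_le_sum hterm).trans ?_)
  rw [← Finset.sum_mul, ← hK]
  calc K * Xe ≤ (K + 1) * Xe := by gcongr; linarith
    _ = (K + 1) * Real.log M ^ m / Real.log M ^ 0 := by rw [hXe]; ring

end Summit.Parity.GeneralizedHardyLittlewood.Theorems.MomentsBeyondDiagonal.DiagKernel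

end
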